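import Literature.Geometry.DiscreteGeometry.KissingPatterns
import Literature.Geometry.DiscreteGeometry.LayerShellPatterns
import Mathlib.Analysis.InnerProductSpace.Projection.Reflection
import HarnessLib

/-!
# The hcp dozen is the fcc dozen twinned across a hexagonal plane — cubic-frame bookkeeping
# (crux `GenericWallFloor`, line `WallLedgerG`; E2 single-dozen algebra)

HONEST FRAMING. Part of the venture `Summits/Ventures/Crystal3D` (cell `crystal3d-full`), helper
`--supports` the crux `GenericWallFloor` (stmt-Ventures-19480) of `route-Ventures-StickyWulffConstant`,
registered line `WallLedgerG` (planner cf-p1 gen 16/22), open stub `stub_twoSlabAdhesion` — general-filling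
step, per-ball programme E2 (cf-p1 ROUTE.md §80(6)–(9)).  Pure pattern bookkeeping for the sequel
`…GenericWallFloorSlotDozens` (dozen rigidity, pattern form), in the common CUBIC frame of
`Literature/Geometry/DiscreteGeometry/KissingPatterns.lean` (`fccKissingPattern = fccInt/√2`,
`hcpKissingPattern = hcpInt/√18`):

* the TWIN REFLECTION `R = ((ℝ ∙ (1,1,1))ᗮ).reflection`, `R x = x − ⅔(x₀+x₁+x₂)·(1,1,1)` (Mathlib's
  reflection in the hexagonal plane `x₀+x₁+x₂ = 0`; `twinRefl_apply`);
* coordinate sums on the cuboctahedron are `0, ±√2` (`sum_coord_of_mem_fcc`);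
* **anticuboctahedron = twinned cuboctahedron**: `hcpKissingPattern` consists of the fcc vectors with
  `x₀+x₁+x₂ ≥ 0` (hexagon + upper triple) and the `R`-images of the upper triple (`mem_hcp_cases`,
  `mem_hcp_of_mem_fcc_of_nonneg`, `twinRefl_mem_hcp_of_mem_fcc_of_pos`); it is `R`-symmetric
  (`twinRefl_image_hcp`);
* the MENU TRICK (`inner_fcc_twinRefl_of_pos`): an upper fcc vector and the `R`-image of an upper fcc
  vector have inner product `−1/3` or `−5/6` — never a slot value `1, ½, 0, −½, −1` — so a set of slots of
  ONE grain inside an hcp dozen never meets both the upper triple and its twin image.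

All finite facts are integer statements about `fccInt`/`hcpInt` checked by `decide`
(`fccInt_sum_cases`, `hcpInt_mem_cases`, `three_smul_mem_hcpInt`, `twin_mem_hcpInt`, `dot_three_smul_twin`).

WHAT THIS IS NOT: nothing about packings, lattices or walls; rung F-C1 not moved.
-/

noncomputable section

namespace Summit.Ventures.Crystal3D.Theorems

open Literature.Geometry.DiscreteGeometry Finset
open scoped InnerProductSpace

/-! ### Integer bookkeeping (kernel `decide`) -/

/-- Coordinate sums of the twelve fcc integer vectors are `0` or `±2`. -/
theorem fccInt_sum_cases : ∀ v ∈ fccInt, v 0 + v 1 + v 2 = 0 ∨ v 0 + v 1 + v 2 = 2 ∨ v 0 + v 1 + v 2 = -2 := by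
  decide

/-- The hcp integer model is the union of the non-negative half of `3·fccInt` and the twin images
`3v − 2(v₀+v₁+v₂)·(1,1,1)` of its positive triple. -/
theorem hcpInt_mem_cases : ∀ u ∈ hcpInt,
    (∃ v ∈ fccInt, 0 ≤ v 0 + v 1 + v 2 ∧ u = (3 : ℤ) • v) ∨
    (∃ v ∈ fccInt, 0 < v 0 + v 1 + v 2 ∧
      u = (3 : ℤ) • v - (2 * (v 0 + v 1 + v 2)) • ![(1 : ℤ), 1, 1]) := by
  decide

/-- Conversely: the non-negative half of `3·fccInt` lies in the hcp model. -/
theorem three_smul_mem_hcpInt : ∀ v ∈ fccInt, 0 ≤ v 0 + v 1 + v 2 → (3 : ℤ) • v ∈ hcpInt := by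
  decide

/-- Conversely: the twin images of the positive triple lie in the hcp model. -/
theorem twin_mem_hcpInt : ∀ v ∈ fccInt, 0 < v 0 + v 1 + v 2 →
    (3 : ℤ) • v - (2 * (v 0 + v 1 + v 2)) • ![(1 : ℤ), 1, 1] ∈ hcpInt := by
  decide

/-- The MENU TRICK, integer form: a positive fcc vector and the twin image of a positive fcc vector
have (scaled) inner product `−6` or `−15` (i.e. `−1/3` or `−5/6`), never a slot value. -/
theorem dot_three_smul_twin : ∀ v ∈ fccInt, ∀ w ∈ fccInt, 0 < v 0 + v 1 + v 2 → 0 < w 0 + w 1 + w 2 →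
    (∑ i, ((3 : ℤ) • v) i * ((3 : ℤ) • w - (2 * (w 0 + w 1 + w 2)) • ![(1 : ℤ), 1, 1]) i = -6 ∨
     ∑ i, ((3 : ℤ) • v) i * ((3 : ℤ) • w - (2 * (w 0 + w 1 + w 2)) • ![(1 : ℤ), 1, 1]) i = -15) := by
  decide

/-! ### Real-side plumbing -/

/-- `⟪(1,1,1), x⟫ = x₀ + x₁ + x₂`. -/
theorem inner_diag (x : EuclideanSpace ℝ (Fin 3)) :
    ⟪(intVec ![1, 1, 1] : EuclideanSpace ℝ (Fin 3)), x⟫_ℝ = x 0 + x 1 + x 2 := by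
  simp [PiLp.inner_apply, Fin.sum_univ_three, intVec_apply]

/-- `‖(1,1,1)‖² = 3`. -/
theorem norm_diag_sq : ‖(intVec ![1, 1, 1] : EuclideanSpace ℝ (Fin 3))‖ ^ 2 = 3 := by
  rw [← real_inner_self_eq_norm_sq, inner_diag]
  simp [intVec_apply]; norm_num

/-- **The twin reflection** across the hexagonal plane `x₀ + x₁ + x₂ = 0` of the cubic frame:
`R x = x − ⅔(x₀+x₁+x₂)·(1,1,1)`. -/
theorem twinRefl_apply (x : EuclideanSpace ℝ (Fin 3)) :
    (ℝ ∙ (intVec ![1, 1, 1] : EuclideanSpace ℝ (Fin 3)))ᗮ.reflection x =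
      x - ((2 / 3 : ℝ) * (x 0 + x 1 + x 2)) • intVec ![1, 1, 1] := by
  rw [Submodule.reflection_orthogonal_apply, Submodule.reflection_singleton_apply, inner_diag]
  have h3 : ((‖(intVec ![1, 1, 1] : EuclideanSpace ℝ (Fin 3))‖ : ℝ) : ℝ) ^ 2 = 3 := norm_diag_sq
  simp only [RCLike.ofReal_real_eq_id, id_eq] at *
  rw [h3]
  ext i
  fin_cases i <;> simp [intVec_apply, two_smul] <;> ring

/-- Coordinates of the twin reflection. -/
theorem twinRefl_apply_coord (x : EuclideanSpace ℝ (Fin 3)) (i : Fin 3) :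
    (ℝ ∙ (intVec ![1, 1, 1] : EuclideanSpace ℝ (Fin 3)))ᗮ.reflection x i =
      x i - (2 / 3 : ℝ) * (x 0 + x 1 + x 2) := by
  rw [twinRefl_apply]
  fin_cases i <;> simp [intVec_apply]

/-- The twin reflection fixes the hexagonal plane. -/
theorem twinRefl_of_sum_eq_zero {x : EuclideanSpace ℝ (Fin 3)} (hx : x 0 + x 1 + x 2 = 0) :
    (ℝ ∙ (intVec ![1, 1, 1] : EuclideanSpace ℝ (Fin 3)))ᗮ.reflection x = x := by
  rw [twinRefl_apply, hx, mul_zero, zero_smul, sub_zero]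

/-- `√18 = 3 √2` as used for the two scales of `KissingPatterns`. -/
theorem sqrt18_eq : Real.sqrt ((18 : ℕ) : ℝ) = 3 * Real.sqrt ((2 : ℕ) : ℝ) := by
  push_cast
  rw [show (18 : ℝ) = 3 ^ 2 * 2 by norm_num, Real.sqrt_mul (by norm_num), Real.sqrt_sq (by norm_num)]

/-- An fcc pattern vector at the hcp scale: `v/√2 = (3v)/√18`. -/
theorem fcc_scaled_eq (v : Fin 3 → ℤ) :
    ((Real.sqrt ((2 : ℕ) : ℝ))⁻¹ • intVec v : EuclideanSpace ℝ (Fin 3)) =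
      (Real.sqrt ((18 : ℕ) : ℝ))⁻¹ • intVec ((3 : ℤ) • v) := by
  have h2 : (0 : ℝ) < Real.sqrt ((2 : ℕ) : ℝ) := by positivity
  ext i
  simp only [PiLp.smul_apply, smul_eq_mul, intVec_apply, Pi.smul_apply, sqrt18_eq]
  push_cast
  field_simp

/-- The twin image of an fcc pattern vector at the hcp scale:
`R(v/√2) = (3v − 2(v₀+v₁+v₂)(1,1,1))/√18`. -/
theorem twinRefl_fcc_scaled_eq (v : Fin 3 → ℤ) :
    (ℝ ∙ (intVec ![1, 1, 1] : EuclideanSpace ℝ (Fin 3)))ᗮ.reflection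
        ((Real.sqrt ((2 : ℕ) : ℝ))⁻¹ • intVec v) =
      (Real.sqrt ((18 : ℕ) : ℝ))⁻¹ •
        intVec ((3 : ℤ) • v - (2 * (v 0 + v 1 + v 2)) • ![(1 : ℤ), 1, 1]) := by
  have h2 : (0 : ℝ) < Real.sqrt ((2 : ℕ) : ℝ) := by positivity
  ext i
  rw [twinRefl_apply_coord]
  simp only [PiLp.smul_apply, smul_eq_mul, intVec_apply, Pi.smul_apply, Pi.sub_apply, sqrt18_eq]
  fin_cases i <;> simp <;> field_simp

/-- Coordinate sum of a scaled integer vector. -/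
theorem sum_coord_scaled (c : ℝ) (v : Fin 3 → ℤ) :
    (c • intVec v : EuclideanSpace ℝ (Fin 3)) 0 + (c • intVec v : EuclideanSpace ℝ (Fin 3)) 1 +
      (c • intVec v : EuclideanSpace ℝ (Fin 3)) 2 = c * ((v 0 + v 1 + v 2 : ℤ) : ℝ) := by
  simp only [PiLp.smul_apply, smul_eq_mul, intVec_apply]
  push_cast
  ring

/-- Inner product of two integer vectors at the hcp scale. -/
theorem inner_scaled18 (v w : Fin 3 → ℤ) :
    ⟪((Real.sqrt ((18 : ℕ) : ℝ))⁻¹ • intVec v : EuclideanSpace ℝ (Fin 3)),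
      (Real.sqrt ((18 : ℕ) : ℝ))⁻¹ • intVec w⟫_ℝ = ((∑ i, v i * w i : ℤ) : ℝ) / 18 := by
  have h18 : Real.sqrt (18 : ℝ) ^ 2 = 18 := Real.sq_sqrt (by norm_num)
  rw [real_inner_smul_left, real_inner_smul_right]
  simp only [PiLp.inner_apply, intVec_apply, RCLike.inner_apply, conj_trivial, Fin.sum_univ_three]
  push_cast
  have h0 : Real.sqrt (18 : ℝ) ≠ 0 := by positivity
  field_simp
  rw [h18]
  ring

/-! ### The fcc / hcp patterns in the cubic frame -/

/-- **Coordinate sums on the cuboctahedron**: `x₀ + x₁ + x₂ ∈ {0, √2, −√2}` for `x ∈ fccKissingPattern`. -/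
theorem sum_coord_of_mem_fcc {x : EuclideanSpace ℝ (Fin 3)} (hx : x ∈ fccKissingPattern) :
    x 0 + x 1 + x 2 = 0 ∨ x 0 + x 1 + x 2 = Real.sqrt 2 ∨ x 0 + x 1 + x 2 = -Real.sqrt 2 := by
  obtain ⟨v, hv, rfl⟩ := Finset.mem_image.1 hx
  rw [sum_coord_scaled]
  have h2 : Real.sqrt ((2 : ℕ) : ℝ) = Real.sqrt 2 := by push_cast; rfl
  have hs : (Real.sqrt 2)⁻¹ * 2 = Real.sqrt 2 := by
    rw [inv_mul_eq_iff_eq_mul₀ (by positivity), Real.mul_self_sqrt (by norm_num)]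
  rcases fccInt_sum_cases v hv with h | h | h
  · left; rw [h]; simp
  · right; left; rw [h, h2]; push_cast; exact hs
  · right; right; rw [h, h2]; push_cast; rw [mul_neg, hs]

/-- **Anticuboctahedron = twinned cuboctahedron** (membership form): every hcp pattern vector is an
fcc pattern vector on the non-negative side of the hexagonal plane, or the twin reflection of an
fcc pattern vector on the positive side. -/
theorem mem_hcp_cases {q : EuclideanSpace ℝ (Fin 3)} (hq : q ∈ hcpKissingPattern) :
    (q ∈ fccKissingPattern ∧ 0 ≤ q 0 + q 1 + q 2) ∨
    (∃ p ∈ fccKissingPattern, 0 < p 0 + p 1 + p 2 ∧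
      q = (ℝ ∙ (intVec ![1, 1, 1] : EuclideanSpace ℝ (Fin 3)))ᗮ.reflection p) := by
  obtain ⟨u, hu, rfl⟩ := Finset.mem_image.1 hq
  have h2 : (0 : ℝ) < (Real.sqrt ((2 : ℕ) : ℝ))⁻¹ := by positivity
  rcases hcpInt_mem_cases u hu with ⟨v, hv, hs, rfl⟩ | ⟨v, hv, hs, rfl⟩
  · left
    refine ⟨Finset.mem_image.2 ⟨v, hv, (fcc_scaled_eq v)⟩, ?_⟩
    rw [← fcc_scaled_eq, sum_coord_scaled]
    exact mul_nonneg h2.le (Int.cast_nonneg hs)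
  · right
    refine ⟨(Real.sqrt ((2 : ℕ) : ℝ))⁻¹ • intVec v, Finset.mem_image.2 ⟨v, hv, rfl⟩, ?_, ?_⟩
    · rw [sum_coord_scaled]; exact mul_pos h2 (Int.cast_pos.2 hs)
    · rw [twinRefl_fcc_scaled_eq]

/-- The non-negative half of the cuboctahedron lies in the anticuboctahedron. -/
theorem mem_hcp_of_mem_fcc_of_nonneg {p : EuclideanSpace ℝ (Fin 3)} (hp : p ∈ fccKissingPattern)
    (hs : 0 ≤ p 0 + p 1 + p 2) : p ∈ hcpKissingPattern := by
  obtain ⟨v, hv, rfl⟩ := Finset.mem_image.1 hp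
  have h2 : (0 : ℝ) < (Real.sqrt ((2 : ℕ) : ℝ))⁻¹ := by positivity
  rw [sum_coord_scaled] at hs
  have hs' : (0 : ℤ) ≤ v 0 + v 1 + v 2 := Int.cast_nonneg_iff.1 ((mul_nonneg_iff_of_pos_left h2).1 hs)
  rw [fcc_scaled_eq]
  exact Finset.mem_image.2 ⟨_, three_smul_mem_hcpInt v hv hs', rfl⟩

/-- The twin image of the positive triple of the cuboctahedron lies in the anticuboctahedron. -/
theorem twinRefl_mem_hcp_of_mem_fcc_of_pos {p : EuclideanSpace ℝ (Fin 3)} (hp : p ∈ fccKissingPattern)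
    (hs : 0 < p 0 + p 1 + p 2) :
    (ℝ ∙ (intVec ![1, 1, 1] : EuclideanSpace ℝ (Fin 3)))ᗮ.reflection p ∈ hcpKissingPattern := by
  obtain ⟨v, hv, rfl⟩ := Finset.mem_image.1 hp
  have h2 : (0 : ℝ) < (Real.sqrt ((2 : ℕ) : ℝ))⁻¹ := by positivity
  rw [sum_coord_scaled] at hs
  have hs' : (0 : ℤ) < v 0 + v 1 + v 2 := Int.cast_pos.1 ((mul_pos_iff_of_pos_left h2).1 hs)
  rw [twinRefl_fcc_scaled_eq]
  exact Finset.mem_image.2 ⟨_, twin_mem_hcpInt v hv hs', rfl⟩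

/-- **The menu trick, real form**: a positive fcc pattern vector and the twin image of a positive fcc
pattern vector have inner product `−1/3` or `−5/6` — never one of the slot values `1, ½, 0, −½, −1`. -/
theorem inner_fcc_twinRefl_of_pos {p q : EuclideanSpace ℝ (Fin 3)} (hp : p ∈ fccKissingPattern)
    (hq : q ∈ fccKissingPattern) (hsp : 0 < p 0 + p 1 + p 2) (hsq : 0 < q 0 + q 1 + q 2) :
    ⟪p, (ℝ ∙ (intVec ![1, 1, 1] : EuclideanSpace ℝ (Fin 3)))ᗮ.reflection q⟫_ℝ = -1 / 3 ∨
      ⟪p, (ℝ ∙ (intVec ![1, 1, 1] : EuclideanSpace ℝ (Fin 3)))ᗮ.reflection q⟫_ℝ = -5 / 6 := by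
  obtain ⟨v, hv, rfl⟩ := Finset.mem_image.1 hp
  obtain ⟨w, hw, rfl⟩ := Finset.mem_image.1 hq
  have h2 : (0 : ℝ) < (Real.sqrt ((2 : ℕ) : ℝ))⁻¹ := by positivity
  rw [sum_coord_scaled] at hsp hsq
  have hsv : (0 : ℤ) < v 0 + v 1 + v 2 := Int.cast_pos.1 ((mul_pos_iff_of_pos_left h2).1 hsp)
  have hsw : (0 : ℤ) < w 0 + w 1 + w 2 := Int.cast_pos.1 ((mul_pos_iff_of_pos_left h2).1 hsq)
  rw [twinRefl_fcc_scaled_eq, fcc_scaled_eq, inner_scaled18]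
  rcases dot_three_smul_twin v hv w hw hsv hsw with h | h
  · left; rw [h]; norm_num
  · right; rw [h]; norm_num

/-- **The anticuboctahedron is symmetric under the twin reflection** (membership form). -/
theorem twinRefl_mem_hcp {q : EuclideanSpace ℝ (Fin 3)} (hq : q ∈ hcpKissingPattern) :
    (ℝ ∙ (intVec ![1, 1, 1] : EuclideanSpace ℝ (Fin 3)))ᗮ.reflection q ∈ hcpKissingPattern := by
  rcases mem_hcp_cases hq with ⟨hqf, hs⟩ | ⟨p, hp, hs, rfl⟩
  · rcases hs.lt_or_eq with hs | hs
    · exact twinRefl_mem_hcp_of_mem_fcc_of_pos hqf hs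
    · rw [twinRefl_of_sum_eq_zero hs.symm]; exact hq
  · rw [Submodule.reflection_reflection]
    exact mem_hcp_of_mem_fcc_of_nonneg hp hs.le

/-- **The anticuboctahedron is symmetric under the twin reflection** (image form). -/
theorem twinRefl_image_hcp :
    (ℝ ∙ (intVec ![1, 1, 1] : EuclideanSpace ℝ (Fin 3)))ᗮ.reflection ''
        (↑hcpKissingPattern : Set (EuclideanSpace ℝ (Fin 3))) = ↑hcpKissingPattern := by
  ext x
  constructor
  · rintro ⟨q, hq, rfl⟩
    exact twinRefl_mem_hcp hq
  · intro hx
    exact ⟨_, twinRefl_mem_hcp hx, Submodule.reflection_reflection _ _⟩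

end Summit.Ventures.Crystal3D.Theorems

end
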